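import Mathlib
import HarnessLib
import Literature.Analysis.FluidPDE.VectorCalculus
import Summits.NavierStokesRegularity.NavierStokesRegularity.Theorems.ThreadingFluxHorizonTowerL2ClosedForm
import Summits.NavierStokesRegularity.NavierStokesRegularity.Theorems.UnthreadedDoorAntidynamoEvenRungRadialProfiles
import Summits.NavierStokesRegularity.NavierStokesRegularity.Theorems.UnthreadedDoorAntidynamoEvenRungStrainKill
import Summits.NavierStokesRegularity.NavierStokesRegularity.Theorems.UnthreadedDoorAntidynamoHarmonicLogGrowth
import Summits.NavierStokesRegularity.NavierStokesRegularity.Theorems.UnthreadedDoorAntidynamoEvenRungKinematicRemainder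
import Summits.NavierStokesRegularity.NavierStokesRegularity.Theorems.UnthreadedDoorAntidynamoEvenRungStagnation

/-!
# Route `UnthreadedDoor` / `ThreadingFlux`, crux `PoloidalLiouville` (stmt-NavierStokesRegularity-1222), antidynamo v2 skeleton,
# rung `stub_singleDegreeRung`, EVEN degree — (E1, kinematic half) THE NORMAL FORM OF AN EVEN SLICE: a non-constant slice IS the
# explicit single-degree field, `v t (x₀ + y) = (a(‖y‖)P(y))•y + k(‖y‖)•∇P(y)`

Support file (census instrument decomp-ns-census-1 g34, cell decomp-ns; `--supports stmt-NavierStokesRegularity-1222 --as helper`; 0 kit).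

ASSEMBLY of the census's (E1) kinematic chain, all tree theorems: radial profiles (E1a, p813766 `exists_radialProfiles`), the kinematic
remainder (E1b, p814077 `kinematicRemainder`: `w = v t(x₀ + ·) − V` is smooth, curl-free, divergence-free, `O(r log r)`), harmonic maps
of growth `O(r log r)` are affine with symmetric trace-free linear part (E1b′, p813976 `affine_symm_traceFree_of_curl_div_log_growth`), the
stagnation alternative (p812603: `v t x₀ = 0` or the slice is constant, EVEN `l`) and the strain kill (E1c, p813842 `strainKill`: the linear
part is `κ•∇P`, absorbed into `k`).

* `inner_singleDegreeField_self` — the radial reading `⟪V y, y⟫ = (a r² + l k)·P(y)` (Euler);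
* ★★ `evenRung_normalForm` — under the rung's VERBATIM hypotheses with `Even l`, `P ≠ 0`, at a slice `t < 0`, for ANY amplitude
  `ĝ ∈ C^∞(0,∞)` with `|ĝ(r)|·r^l` bounded representing `curl (v t)` off `x₀`: EITHER the slice is constant, OR there are `a k ∈ C^∞(0,∞)` with
  `ĝ = a − k′/r`, `r a′ + (l+3)a + l k′/r = 0` (the letters hG/hdiv of `singleDegreeRung_of_sliceData`) AND
  `∀ y, v t (x₀ + y) = (a(‖y‖)P(y))•y + k(‖y‖)•∇P(y)`.

MEANING: the kinematic normal form that the (E1) hand owed is now a theorem; what remains for `hE1` is only the DYNAMIC identity `hid` (coefficients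
`c, e` from the vorticity equation via `curl_lamb_eq_radial` + `laplacian_radial_smul_cross_gradient`) — (E1d).

HONEST LABEL: composition of tree theorems serving the open EVEN-degree rung of an S-free Liouville engine; the rung, the wall
`stub_scalarLiouville`, `PoloidalLiouville` (1222) and Navier–Stokes regularity are NOT touched (crux 1222 is INCOMPARABLE with the summit;
descent inside the door's cone, decorative for the summit).  Nothing here proves NavierStokesRegularity. [folklore]
-/

noncomputable section

-- the summit and its single sub-problem share the name (CONVENTIONS §1), as in every Theorems file
set_option linter.dupNamespace false

open scoped Topology InnerProductSpace RealInnerProductSpace ContDiff Laplacian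
open Filter Set Metric MeasureTheory MvPolynomial
open Literature.Analysis.FluidPDE

namespace Summit.NavierStokesRegularity.NavierStokesRegularity.Theorems.PoloidalLiouville.Antidynamo

open Summit.NavierStokesRegularity.NavierStokesRegularity.Theorems.PoloidalLiouville.HorizonTower (inner_gradient_self_of_homogeneous_nat)

/-- THE RADIAL READING of the single-degree field: `⟪(a(r)P)•y + k(r)•∇P, y⟫ = (a(r) r² + l k(r))·P(y)` (Euler). [folklore] -/
theorem inner_singleDegreeField_self {P : EuclideanSpace ℝ (Fin 3) → ℝ} {l : ℕ} (hEuler : ∀ z, ⟪gradient P z, z⟫ = (l : ℝ) * P z)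
    (a k : ℝ → ℝ) (y : EuclideanSpace ℝ (Fin 3)) :
    ⟪(a ‖y‖ * P y) • y + k ‖y‖ • gradient P y, y⟫ = (a ‖y‖ * ‖y‖ ^ 2 + (l : ℝ) * k ‖y‖) * P y := by
  rw [inner_add_left, inner_smul_left, inner_smul_left, conj_trivial, conj_trivial, real_inner_self_eq_norm_sq, hEuler y]
  ring

/-- ★★ **THE NORMAL FORM OF AN EVEN SLICE.**  Under the rung's VERBATIM hypotheses (bounded ancient mild solution, measurable slices, jointly
smooth, single-degree slices `v t = ∇φ + (g P(· − x₀))•(· − x₀)` for a non-zero solid harmonic `P` of EVEN degree `l ≥ 2`), fix `t < 0` and an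
amplitude `ĝ ∈ C^∞(0,∞)` with `|ĝ(r)|·r^l ≤ K` representing the vorticity off the centre, `curl (v t) x = ĝ(‖x − x₀‖)•(∇P(x − x₀) × (x − x₀))`.
Then EITHER the slice is constant, OR there are radial profiles `a k ∈ C^∞(0,∞)` with `ĝ = a − k′/r`, `r a′ + (l+3)a + l k′/r = 0` and
`v t (x₀ + y) = (a(‖y‖)P(y))•y + k(‖y‖)•∇P(y)` for EVERY `y`. [folklore] -/
theorem evenRung_normalForm
    (v : ℝ → EuclideanSpace ℝ (Fin 3) → EuclideanSpace ℝ (Fin 3)) (x₀ : EuclideanSpace ℝ (Fin 3))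
    (hB : Literature.Analysis.FluidPDE.IsBoundedAncientMildSolution 1 v)
    (hm : ∀ t < 0, AEStronglyMeasurable (v t) volume)
    (hsm : ContDiffOn ℝ (⊤ : ℕ∞) (Function.uncurry v) (Set.Iio 0 ×ˢ Set.univ))
    {l : ℕ} {P : MvPolynomial (Fin 3) ℝ} (hl : 2 ≤ l) (hev : Even l) (hP : P.IsHomogeneous l) (hP0 : P ≠ 0)
    (hharm : ∀ y : EuclideanSpace ℝ (Fin 3),
      Laplacian.laplacian (fun z : EuclideanSpace ℝ (Fin 3) => MvPolynomial.eval (fun i => z i) P) y = 0)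
    (hrep : ∀ t < 0, ∃ (g : ℝ → ℝ) (φ : EuclideanSpace ℝ (Fin 3) → ℝ), ∀ x,
      v t x = gradient φ x + (g ‖x - x₀‖ * MvPolynomial.eval (fun i => (x - x₀) i) P) • (x - x₀))
    {t : ℝ} (ht : t < 0) {ĝ : ℝ → ℝ} (hĝs : ContDiffOn ℝ ∞ ĝ (Ioi 0)) {K : ℝ} (hĝK : ∀ r, 0 < r → |ĝ r| * r ^ l ≤ K)
    (hcurl : ∀ x : EuclideanSpace ℝ (Fin 3), x ≠ x₀ →
      curl (v t) x = ĝ ‖x - x₀‖ •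
        cross (gradient (fun z : EuclideanSpace ℝ (Fin 3) => MvPolynomial.eval (fun i => z i) P) (x - x₀)) (x - x₀)) :
    (∃ b : EuclideanSpace ℝ (Fin 3), ∀ x, v t x = b) ∨
      ∃ a k : ℝ → ℝ, ContDiffOn ℝ ∞ a (Ioi 0) ∧ ContDiffOn ℝ ∞ k (Ioi 0) ∧
        (∀ r, 0 < r → ĝ r = a r - deriv k r / r) ∧
        (∀ r, 0 < r → r * deriv a r + ((l : ℝ) + 3) * a r + (l : ℝ) * deriv k r / r = 0) ∧
        ∀ y : EuclideanSpace ℝ (Fin 3), v t (x₀ + y) =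
          (a ‖y‖ * MvPolynomial.eval (fun i => y i) P) • y +
            k ‖y‖ • gradient (fun z : EuclideanSpace ℝ (Fin 3) => MvPolynomial.eval (fun i => z i) P) y := by
  -- the stagnation alternative: WLOG `v t x₀ = 0`
  rcases evenRung_stagnation_alternative v x₀ hB hm hsm hl hev hP hharm hrep t ht with hstag | hconst
  swap
  · exact Or.inl hconst
  right
  -- the profile
  set Q : EuclideanSpace ℝ (Fin 3) → ℝ := fun z => MvPolynomial.eval (fun i => z i) P with hQ
  have hQs : ContDiff ℝ ∞ Q := (contDiff_omega_evalPoly P).of_le le_top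
  have hQ2 : ContDiff ℝ 2 Q := (contDiff_omega_evalPoly P).of_le (by norm_cast)
  have hQhom : ∀ r : ℝ, 0 < r → ∀ y : EuclideanSpace ℝ (Fin 3), Q (r • y) = r ^ l * Q y :=
    fun r _ y => evalPoly_smul hP r y
  have hQhom' : ∀ (c : ℝ) (y : EuclideanSpace ℝ (Fin 3)), Q (c • y) = c ^ l * Q y := fun c y => evalPoly_smul hP c y
  have hEuler : ∀ z : EuclideanSpace ℝ (Fin 3), ⟪gradient Q z, z⟫ = (l : ℝ) * Q z := fun z =>
    inner_gradient_self_of_homogeneous_nat ((hQ2.differentiable (by norm_num)) z) hQhom'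
  have hQne : ∃ y, Q y ≠ 0 := exists_evalPoly_ne_zero hP0
  -- the slice
  have hsm' : IsSmoothSpaceTimeOn (Iio 0) v := hsm
  have hu : ContDiff ℝ ∞ (v t) := hsm'.contDiff_slice ht
  obtain ⟨M, hM⟩ := hB.isBoundedOn
  have hMt : ∀ x, ‖v t x‖ ≤ M := fun x => hM t ht x
  have hdivu : VectorCalculus.IsDivFree (v t) :=
    (hB.isAncientMildSolution.1 t ht).isDivFree_of_contDiff (hu.of_le (by norm_cast))
  -- (E1a) the radial profiles
  obtain ⟨a, k, ha, hk, hG, hdiv, C, haC, hkC⟩ := exists_radialProfiles hl hĝs hĝK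
  -- (E1b) the kinematic remainder
  set w : EuclideanSpace ℝ (Fin 3) → EuclideanSpace ℝ (Fin 3) :=
    fun y => v t (x₀ + y) - ((a ‖y‖ * Q y) • y + k ‖y‖ • gradient Q y) with hwdef
  obtain ⟨hws, hwcurl, hwdiv, A, B, hwg⟩ := kinematicRemainder hu hMt hdivu x₀ hQs hl hQhom hEuler hharm ha hk hG hdiv haC hkC
    hcurl (w := w) (fun y => rfl)
  -- (E1b′) the remainder is affine with symmetric trace-free linear part
  obtain ⟨haff, hTs, hTtr⟩ := affine_symm_traceFree_of_curl_div_log_growth hws hwcurl hwdiv hwg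
  set T : EuclideanSpace ℝ (Fin 3) →L[ℝ] EuclideanSpace ℝ (Fin 3) := fderiv ℝ w 0 with hT
  -- the centre: `w 0 = v t x₀ = 0`
  obtain ⟨hg0, -⟩ := exists_norm_gradient_le_mul_pow_of_homogeneous (hQs.of_le (by norm_cast)) hl hQhom
  have hw0 : w 0 = 0 := by
    simp only [hwdef, add_zero, norm_zero, smul_zero, hg0, sub_zero]
    exact hstag
  have hvt : ∀ y, v t (x₀ + y) = ((a ‖y‖ * Q y) • y + k ‖y‖ • gradient Q y) + T y := by
    intro y
    have h := haff y
    rw [hw0, zero_add] at h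
    have : v t (x₀ + y) = w y + ((a ‖y‖ * Q y) • y + k ‖y‖ • gradient Q y) := by
      simp only [hwdef, sub_add_cancel]
    rw [this, h, add_comm]
  -- (E1c) the strain kill: `T = κ•∇Q`
  have hrad : ∀ y, ⟪v t (x₀ + y), y⟫ = (a ‖y‖ * ‖y‖ ^ 2 + (l : ℝ) * k ‖y‖) * Q y + ⟪T y, y⟫ := by
    intro y
    rw [hvt y, inner_add_left, inner_singleDegreeField_self hEuler]
  obtain ⟨⟨κ, hκ⟩, -⟩ := strainKill hQ2 hl hQhom hharm hQne T hTs hTtr (w := fun y => v t (x₀ + y)) (fun y => hMt _)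
    (m := fun r => a r * r ^ 2 + (l : ℝ) * k r) hrad
  -- conclude with `k + κ`
  refine ⟨a, fun r => k r + κ, ha, hk.add contDiffOn_const, fun r hr => ?_, fun r hr => ?_, fun y => ?_⟩
  · rw [hG r hr, deriv_add_const]
  · rw [deriv_add_const]; exact hdiv r hr
  · rw [hvt y, hκ y, add_smul, add_assoc]

end Summit.NavierStokesRegularity.NavierStokesRegularity.Theorems.PoloidalLiouville.Antidynamo

end
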